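import Literature.Analysis.SegalBargmann.FockSubstitutionEigenvectors
import Literature.RingTheory.MvPolynomial.TorusScaling
import Mathlib.RingTheory.MvPolynomial.EulerIdentity
import HarnessLib

/-!
# The `det`-isotypic Fock polynomials of `U(2) × U(1) ⊂ U(2,1)` against a definite plane: `ℂ · det(z)` times the
# other variables (Kashiwara–Vergne 1978 Ch. III; Adams 2007 §§4–6), at GROUP level and by elementary algebra

Topic `Analysis/SegalBargmann`; continuation of `FockSubstitutionEigenvectors` (`det2 x = z₀₀z₁₁ − z₀₁z₁₀` and its
substitution law `linSubst_det2`).  In the Fock model of the dual pair `(U(2,1), U(2))` (PerL v5 Lemma 4.1(b), place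
`ι₁`: "`𝓕_b = ℂ[z_{aj}, w_j]`, `K_V`-weight of `z^A w^E` = (row sums of `A`; `−2−|E|`) … the `K_V`-type `κ = (1,1;−2)`
forces `|E| = 0` and row sums `(1,1)` … its `U(2)_V`-invariants twisted by `det` form the line `ℂ det(z)`") the
`κ`-isotypic vectors are determined by three GROUP elements of the maximal compact `K_V = U(2) × U(1)`: the two row
circles `diag(u,1)`, `diag(1,u)` of `U(2)` (row degrees `(1,1)`), the centre of `U(1)` (no `w`), and the row swap
`(0 1; 1 0) ∈ U(2)` (`det = −1`: antisymmetry).  This file proves the corresponding ALGEBRAIC classification in a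
polynomial ring `ℂ[X_τ]` containing a `2 × 2` array of variables `z_{aj} = X (x a j)` (the other variables — the `w_j`,
the variables of the other places — being arbitrary coefficients):

* §1 weights: the row indicators `rowWt x a` and the bridge from circle eigen-equations of the diagonal substitutions
  `linSubst (indScale A u)` (`u ∈ S¹`) to weighted homogeneity (`isWeightedHomogeneous_indWt_of_linSubst`, via tree
  `TorusScaling.isWeightedHomogeneous_of_torusAct`); weight `0` for an indicator weight means the indicated variables do
  not occur (`notMem_vars_of_indWt_zero`).
* §2 **structure**: row weights `(1,1)` ⟹ `F = Σ_{j,j'} z_{0j} z_{1j'} · ∂_{1j'}∂_{0j} F` with `z`-free coefficients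
  (Euler's identity twice, Mathlib `IsWeightedHomogeneous.sum_weight_X_mul_pderiv`).
* §3 **antisymmetry**: if moreover `F(rows swapped) = −F` then **`F = det2 x * G`** with `G = ∂_{11}∂_{00} F` free of
  the `z`-variables (`eq_det2_mul_of_rowSwap`); conversely such products have row weights `(1,1)` and are antisymmetric.

With `linSubst_det2` (the array substituted by `N` rescales `det2` by `det N`) this is the group-level form of PerL's
"`𝓕^κ_{ι₁} = ℂ det(z)`" inside the polynomial ring of ALL archimedean variables: a `κ`-isotypic Fock polynomial is
`det(z) ·` (a polynomial in the variables of the other places).  Print sources for the `K`-type structure of these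
Fock models: M. Kashiwara, M. Vergne, Invent. Math. 44 (1978) Ch. III §§5–7; J. Adams, *The theta correspondence over
ℝ* (2007) Prop. 6.6, §7; PerL's own source [Y1neg L3.1] is NOT used.  Everything below is proved (folklore algebra).

## References

* [KashiwaraVergne1978] M. Kashiwara, M. Vergne, *On the Segal–Shale–Weil representations and harmonic polynomials*,
  Invent. Math. 44 (1978) 1–47, Ch. III (5.1)–(7.2). [cite: KashiwaraVergne1978, Ch. III §5]
* [Adams2007Theta] J. Adams, The theta correspondence over `ℝ`, Lect. Notes Ser. IMS NUS 12 (2007), Prop. 6.6, §7.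

Provenance: LEAN-IN-TREE rule (2026-08-18), pub-hodgecm model-construction sub-cell, seat mc-binder-2 gen 5; KERNEL only.
-/

noncomputable section

open MvPolynomial Finsupp
open scoped BigOperators

namespace Literature.Analysis.SegalBargmann

variable {τ : Type*} [DecidableEq τ]

/-! ## §1  Indicator weights, circle scalings, absent variables -/

section Weights

/-- The indicator weight of a set of variables `A ⊆ τ` (`1` on `A`, `0` elsewhere). [folklore] -/
def indWt (A : Finset τ) : τ → ℕ := fun i => if i ∈ A then 1 else 0

/-- The weight of a monomial for an indicator weight is its total degree in the indicated variables. [folklore] -/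
theorem weight_indWt (A : Finset τ) (d : τ →₀ ℕ) : weight (indWt A) d = ∑ i ∈ A, d i := by
  classical
  rw [weight_apply, Finsupp.sum]
  simp only [indWt, smul_eq_mul, mul_ite, mul_one, mul_zero]
  rw [Finset.sum_ite_mem]
  refine Finset.sum_subset Finset.inter_subset_right fun i hiA hi => ?_
  rw [Finset.mem_inter, not_and'] at hi
  exact Finsupp.notMem_support_iff.mp (hi hiA)

/-- **Weight `0` for an indicator weight: the indicated variables do not occur.** [folklore] -/
theorem coeff_eq_zero_of_indWt_zero {A : Finset τ} {F : MvPolynomial τ ℂ} (hF : IsWeightedHomogeneous (indWt A) F 0)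
    {d : τ →₀ ℕ} {i : τ} (hi : i ∈ A) (hd : d i ≠ 0) : coeff d F = 0 := by
  by_contra h
  have hw := hF h
  rw [weight_indWt] at hw
  exact hd (Finset.sum_eq_zero_iff.mp hw i hi)

/-- … equivalently, they are not among the `vars`. [folklore] -/
theorem notMem_vars_of_indWt_zero {A : Finset τ} {F : MvPolynomial τ ℂ} (hF : IsWeightedHomogeneous (indWt A) F 0)
    {i : τ} (hi : i ∈ A) : i ∉ F.vars := by
  classical
  rw [mem_vars_iff_mem_support]
  rintro ⟨d, hd, hid⟩
  exact (MvPolynomial.mem_support_iff.mp hd) (coeff_eq_zero_of_indWt_zero hF hi (Finsupp.mem_support_iff.mp hid))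

/-- A partial derivative in an absent variable vanishes. [folklore] -/
theorem pderiv_eq_zero_of_indWt_zero {A : Finset τ} {F : MvPolynomial τ ℂ}
    (hF : IsWeightedHomogeneous (indWt A) F 0) {i : τ} (hi : i ∈ A) : pderiv i F = 0 :=
  pderiv_eq_zero_of_notMem_vars (notMem_vars_of_indWt_zero hF hi)

/-- **The circle scaling of the variables in `A`**: the diagonal substitution matrix `diag(u on A, 1 elsewhere)`.
[folklore] -/
def indScale (A : Finset τ) (u : ℂ) : Matrix τ τ ℂ := Matrix.diagonal fun i => if i ∈ A then u else 1

/-- The scaling is the torus element `torusAct (indWt A) u` of `TorusScaling`. [folklore] -/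
theorem linSubst_indScale [Fintype τ] (A : Finset τ) (u : ℂˣ) :
    linSubst (indScale A (u : ℂ)) = Literature.RingTheory.MvPolynomial.torusAct (fun i => (indWt A i : ℤ)) u := by
  refine MvPolynomial.algHom_ext fun k => ?_
  rw [linSubst_X, Literature.RingTheory.MvPolynomial.torusAct_X,
    Finset.sum_eq_single k (fun j _ hj => by rw [indScale, Matrix.diagonal_apply_ne _ (Ne.symm hj), map_zero, zero_mul])
      (fun h => (h (Finset.mem_univ k)).elim), indScale, Matrix.diagonal_apply_eq]
  by_cases hk : k ∈ A
  · simp [indWt, hk]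
  · simp [indWt, hk]

omit [DecidableEq τ] in
/-- `ℕ`-valued and `ℤ`-valued weighted homogeneity agree for an `ℕ`-weight. [folklore] -/
theorem isWeightedHomogeneous_nat_iff_int (w : τ → ℕ) (F : MvPolynomial τ ℂ) (n : ℕ) :
    IsWeightedHomogeneous w F n ↔ IsWeightedHomogeneous (fun i => (w i : ℤ)) F (n : ℤ) := by
  have hw : ∀ d : τ →₀ ℕ, weight (fun i => (w i : ℤ)) d = ((weight w d : ℕ) : ℤ) := fun d => by
    rw [weight_apply, weight_apply, Finsupp.sum, Finsupp.sum, Nat.cast_sum]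
    refine Finset.sum_congr rfl fun i _ => ?_
    rw [smul_eq_mul, nsmul_eq_mul, Nat.cast_mul]
  constructor
  · intro h d hd; rw [hw, h hd]
  · intro h d hd; have := h hd; rw [hw] at this; exact_mod_cast this

/-- **From the GROUP to the weights**: if the circle scaling of the variables in `A` acts on `F` by `u^n` for every
`u` on the unit circle, then `F` is weighted-homogeneous of weight `n` for the indicator of `A`. [folklore] -/
theorem isWeightedHomogeneous_indWt_of_linSubst [Fintype τ] (A : Finset τ) {F : MvPolynomial τ ℂ} {n : ℕ}
    (h : ∀ u : ℂ, ‖u‖ = 1 → linSubst (indScale A u) F = u ^ n • F) : IsWeightedHomogeneous (indWt A) F n := by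
  rw [isWeightedHomogeneous_nat_iff_int]
  refine Literature.RingTheory.MvPolynomial.isWeightedHomogeneous_of_torusAct _ fun u hu => ?_
  rw [← linSubst_indScale, h u hu]
  norm_cast

end Weights

/-! ## §2  Row weights `(1,1)`: the structure of `F` -/

section Rows

variable (x : Fin 2 → Fin 2 → τ)

/-- The variables of row `a` of the array: `{x a 0, x a 1}`. [folklore] -/
def rowVars (a : Fin 2) : Finset τ := Finset.univ.image (x a)

/-- The row-`a` indicator weight. [folklore] -/
abbrev rowWt (a : Fin 2) : τ → ℕ := indWt (rowVars x a)

variable {x}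

/-- `x a j ∈ rowVars x a`. [folklore] -/
theorem mem_rowVars (a j : Fin 2) : x a j ∈ rowVars x a := Finset.mem_image.mpr ⟨j, Finset.mem_univ _, rfl⟩

/-- For an injective array the two rows are disjoint: `x b j ∉ rowVars x a` for `b ≠ a`. [folklore] -/
theorem notMem_rowVars (hx : Function.Injective fun p : Fin 2 × Fin 2 => x p.1 p.2) {a b : Fin 2} (hab : b ≠ a)
    (j : Fin 2) : x b j ∉ rowVars x a := by
  intro h
  obtain ⟨j', _, hj'⟩ := Finset.mem_image.mp h
  have := hx (a₁ := (a, j')) (a₂ := (b, j)) hj'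
  exact hab (Prod.mk.inj this).1.symm

/-- The row weight of a variable of the same row is `1`, of the other row `0`. [folklore] -/
theorem rowWt_apply_same (a j : Fin 2) : rowWt x a (x a j) = 1 := by
  simp [rowWt, indWt, mem_rowVars]

/-- [folklore] -/
theorem rowWt_apply_other (hx : Function.Injective fun p : Fin 2 × Fin 2 => x p.1 p.2) {a b : Fin 2} (hab : b ≠ a)
    (j : Fin 2) : rowWt x a (x b j) = 0 := by
  simp [rowWt, indWt, notMem_rowVars hx hab j]

/-- **Euler's identity for a row**: if `F` has row-`a` weight `1` then `F = Σ_j z_{aj} ∂_{aj} F`. [folklore] -/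
theorem eq_sum_X_mul_pderiv_row [Fintype τ] (hx : Function.Injective fun p : Fin 2 × Fin 2 => x p.1 p.2) (a : Fin 2)
    {F : MvPolynomial τ ℂ} (hF : IsWeightedHomogeneous (rowWt x a) F 1) :
    F = ∑ j : Fin 2, X (x a j) * pderiv (x a j) F := by
  have h := hF.sum_weight_X_mul_pderiv
  rw [one_smul] at h
  have hinj : Function.Injective (x a) := fun j j' hjj' => (Prod.mk.inj (hx (a₁ := (a, j)) (a₂ := (a, j')) hjj')).2
  symm
  calc ∑ j : Fin 2, X (x a j) * pderiv (x a j) F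
      = ∑ i ∈ rowVars x a, rowWt x a i • (X i * pderiv i F) := by
        rw [rowVars, Finset.sum_image fun j _ j' _ h => hinj h]
        exact Finset.sum_congr rfl fun j _ => by rw [rowWt_apply_same, one_smul]
    _ = ∑ i, rowWt x a i • (X i * pderiv i F) :=
        Finset.sum_subset (Finset.subset_univ _) fun i _ hi => by
          rw [show rowWt x a i = 0 by simp [rowWt, indWt, hi], zero_smul]
    _ = F := h

/-- **Structure of a polynomial with row weights `(1,1)`**: `F = Σ_{j,j'} z_{0j} z_{1j'} · ∂_{1j'} ∂_{0j} F`.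
[folklore] -/
theorem eq_sum_XX_mul_pderiv₂ [Fintype τ] (hx : Function.Injective fun p : Fin 2 × Fin 2 => x p.1 p.2) {F : MvPolynomial τ ℂ}
    (h0 : IsWeightedHomogeneous (rowWt x 0) F 1) (h1 : IsWeightedHomogeneous (rowWt x 1) F 1) :
    F = ∑ j : Fin 2, ∑ j' : Fin 2, X (x 0 j) * X (x 1 j') * pderiv (x 1 j') (pderiv (x 0 j) F) := by
  conv_lhs => rw [eq_sum_X_mul_pderiv_row hx 0 h0]
  refine Finset.sum_congr rfl fun j _ => ?_
  have h1' : IsWeightedHomogeneous (rowWt x 1) (pderiv (x 0 j) F) 1 :=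
    h1.pderiv (by rw [rowWt_apply_other hx zero_ne_one j, add_zero])
  conv_lhs => rw [eq_sum_X_mul_pderiv_row hx 1 h1']
  rw [Finset.mul_sum]
  refine Finset.sum_congr rfl fun j' _ => ?_
  ring

/-- The double derivatives `∂_{1j'} ∂_{0j} F` have row weights `(0,0)`: no `z`-variable occurs in them. [folklore] -/
theorem pderiv₂_rowWt_zero (hx : Function.Injective fun p : Fin 2 × Fin 2 => x p.1 p.2) {F : MvPolynomial τ ℂ}
    (h0 : IsWeightedHomogeneous (rowWt x 0) F 1) (h1 : IsWeightedHomogeneous (rowWt x 1) F 1) (j j' : Fin 2) (a : Fin 2) :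
    IsWeightedHomogeneous (rowWt x a) (pderiv (x 1 j') (pderiv (x 0 j) F)) 0 := by
  by_cases ha : a = 0
  · subst ha
    exact (h0.pderiv (n' := 0) (by rw [rowWt_apply_same])).pderiv
      (by rw [rowWt_apply_other hx one_ne_zero j', add_zero])
  · obtain rfl : a = 1 := by omega
    exact (h1.pderiv (n' := 1) (by rw [rowWt_apply_other hx zero_ne_one j, add_zero])).pderiv
      (by rw [rowWt_apply_same])

end Rows

/-! ## §3  Antisymmetry under the row swap: `F = det2 x * G` -/

section Swap

variable (x : Fin 2 → Fin 2 → τ)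

/-- The row swap `z_{0j} ↔ z_{1j}` as a permutation of the variables. [folklore] -/
def rowSwap : Equiv.Perm τ := (Equiv.swap (x 0 0) (x 1 0)).trans (Equiv.swap (x 0 1) (x 1 1))

variable {x} (hx : Function.Injective fun p : Fin 2 × Fin 2 => x p.1 p.2)
include hx

omit [DecidableEq τ] in
/-- Distinct positions carry distinct variables. [folklore] -/
theorem x_ne (p q : Fin 2 × Fin 2) (h : p ≠ q) : x p.1 p.2 ≠ x q.1 q.2 :=
  fun e => h (hx e)

/-- The row swap exchanges `x 0 j` and `x 1 j`. [folklore] -/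
theorem rowSwap_apply_row0 (j : Fin 2) : rowSwap x (x 0 j) = x 1 j := by
  simp only [rowSwap, Equiv.trans_apply]
  by_cases hj : j = 0
  · subst hj
    rw [Equiv.swap_apply_left]
    exact Equiv.swap_apply_of_ne_of_ne (x_ne hx (1, 0) (0, 1) (by decide)) (x_ne hx (1, 0) (1, 1) (by decide))
  · obtain rfl : j = 1 := by omega
    rw [Equiv.swap_apply_of_ne_of_ne (x_ne hx (0, 1) (0, 0) (by decide)) (x_ne hx (0, 1) (1, 0) (by decide)),
      Equiv.swap_apply_left]

/-- [folklore] -/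
theorem rowSwap_apply_row1 (j : Fin 2) : rowSwap x (x 1 j) = x 0 j := by
  simp only [rowSwap, Equiv.trans_apply]
  by_cases hj : j = 0
  · subst hj
    rw [Equiv.swap_apply_right]
    exact Equiv.swap_apply_of_ne_of_ne (x_ne hx (0, 0) (0, 1) (by decide)) (x_ne hx (0, 0) (1, 1) (by decide))
  · obtain rfl : j = 1 := by omega
    rw [Equiv.swap_apply_of_ne_of_ne (x_ne hx (1, 1) (0, 0) (by decide)) (x_ne hx (1, 1) (1, 0) (by decide)),
      Equiv.swap_apply_right]

omit hx in
/-- Off the array the row swap is the identity. [folklore] -/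
theorem rowSwap_apply_of_notMem {i : τ} (h0 : i ∉ rowVars x 0) (h1 : i ∉ rowVars x 1) : rowSwap x i = i := by
  have hne : ∀ a j, i ≠ x a j := by
    intro a j e
    subst e
    by_cases ha : a = 0
    · subst ha; exact h0 (mem_rowVars 0 j)
    · obtain rfl : a = 1 := by omega
      exact h1 (mem_rowVars 1 j)
  simp only [rowSwap, Equiv.trans_apply]
  rw [Equiv.swap_apply_of_ne_of_ne (hne 0 0) (hne 1 0), Equiv.swap_apply_of_ne_of_ne (hne 0 1) (hne 1 1)]

omit hx in
/-- A polynomial free of the array variables is fixed by the row swap. [folklore] -/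
theorem rename_rowSwap_eq_self {G : MvPolynomial τ ℂ} (h0 : IsWeightedHomogeneous (rowWt x 0) G 0)
    (h1 : IsWeightedHomogeneous (rowWt x 1) G 0) : rename (rowSwap x) G = G := by
  have key : ∀ i, i ∈ G.vars → rename (rowSwap x) (X i : MvPolynomial τ ℂ) = X i := by
    intro i hi
    have hi0 : i ∉ rowVars x 0 := fun h => notMem_vars_of_indWt_zero h0 h hi
    have hi1 : i ∉ rowVars x 1 := fun h => notMem_vars_of_indWt_zero h1 h hi
    rw [rename_X, rowSwap_apply_of_notMem hi0 hi1]
  have h := hom_congr_vars (f₁ := (rename (rowSwap x) : MvPolynomial τ ℂ →ₐ[ℂ] MvPolynomial τ ℂ).toRingHom)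
    (f₂ := RingHom.id _) (p₁ := G) (by ext r; simp) (fun i hi _ => by simpa using key i hi) rfl
  simpa using h

/-- Extraction of the coefficients of an expansion `Σ_{j,j'} z_{0j} z_{1j'} G_{jj'}` with `z`-free `G`:
`∂_{1k'} ∂_{0k}` returns `G_{kk'}`. [folklore] -/
theorem pderiv₂_sum_XX_mul {G : Fin 2 → Fin 2 → MvPolynomial τ ℂ}
    (hG0 : ∀ j j', IsWeightedHomogeneous (rowWt x 0) (G j j') 0)
    (hG1 : ∀ j j', IsWeightedHomogeneous (rowWt x 1) (G j j') 0) (k k' : Fin 2) :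
    pderiv (x 1 k') (pderiv (x 0 k) (∑ j : Fin 2, ∑ j' : Fin 2, X (x 0 j) * X (x 1 j') * G j j')) = G k k' := by
  -- first derivative, term by term
  have hd0 : ∀ j j', pderiv (x 0 k) (X (x 0 j) * X (x 1 j') * G j j') =
      if j = k then X (x 1 j') * G j j' else 0 := by
    intro j j'
    have hG : pderiv (x 0 k) (G j j') = 0 := pderiv_eq_zero_of_indWt_zero (hG0 j j') (mem_rowVars 0 k)
    have hX1 : pderiv (x 0 k) (X (x 1 j') : MvPolynomial τ ℂ) = 0 :=
      pderiv_X_of_ne (x_ne hx (1, j') (0, k) (by simp))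
    rw [pderiv_mul, hG, mul_zero, add_zero, pderiv_mul, hX1, mul_zero, add_zero]
    by_cases hjk : j = k
    · subst hjk; rw [pderiv_X_self, one_mul, if_pos rfl]
    · rw [pderiv_X_of_ne (x_ne hx (0, j) (0, k) (by simpa using hjk)), zero_mul, zero_mul, if_neg hjk]
  -- second derivative
  have hd1 : ∀ j', pderiv (x 1 k') (X (x 1 j') * G k j') = if j' = k' then G k j' else 0 := by
    intro j'
    have hG : pderiv (x 1 k') (G k j') = 0 := pderiv_eq_zero_of_indWt_zero (hG1 k j') (mem_rowVars 1 k')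
    rw [pderiv_mul, hG, mul_zero, add_zero]
    by_cases hjk : j' = k'
    · subst hjk; rw [pderiv_X_self, one_mul, if_pos rfl]
    · rw [pderiv_X_of_ne (x_ne hx (1, j') (1, k') (by simpa using hjk)), zero_mul, if_neg hjk]
  have hterm : ∀ j j', pderiv (x 1 k') (pderiv (x 0 k) (X (x 0 j) * X (x 1 j') * G j j')) =
      if j = k ∧ j' = k' then G j j' else 0 := by
    intro j j'
    by_cases hj : j = k
    · subst hj
      rw [hd0, if_pos rfl, hd1]
      by_cases hj' : j' = k'
      · rw [if_pos hj', if_pos ⟨rfl, hj'⟩]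
      · rw [if_neg hj', if_neg fun h => hj' h.2]
    · rw [hd0, if_neg hj, map_zero, if_neg fun h => hj h.1]
  simp only [map_sum, hterm]
  rw [Finset.sum_eq_single k, Finset.sum_eq_single k', if_pos ⟨rfl, rfl⟩]
  · intro j' _ hj'; rw [if_neg fun h => hj' h.2]
  · exact fun h => absurd (Finset.mem_univ k') h
  · intro j _ hj; exact Finset.sum_eq_zero fun j' _ => by rw [if_neg fun h => hj h.1]
  · exact fun h => absurd (Finset.mem_univ k) h

/-- From an expansion `F = Σ_{j,j'} z_{0j} z_{1j'} G_{jj'}` with `z`-free coefficients and the antisymmetry of `F`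
under the row swap: `G_{00} = G_{11} = 0`, `G_{10} = −G_{01}`, `F = det2 x * G_{01}`. [folklore] -/
theorem eq_det2_mul_of_expansion {F : MvPolynomial τ ℂ} {G : Fin 2 → Fin 2 → MvPolynomial τ ℂ}
    (hG0 : ∀ j j', IsWeightedHomogeneous (rowWt x 0) (G j j') 0)
    (hG1 : ∀ j j', IsWeightedHomogeneous (rowWt x 1) (G j j') 0)
    (hF : F = ∑ j : Fin 2, ∑ j' : Fin 2, X (x 0 j) * X (x 1 j') * G j j') (hS : rename (rowSwap x) F = -F) :
    F = det2 x * G 0 1 := by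
  have hGfix : ∀ j j', rename (rowSwap x) (G j j') = G j j' := fun j j' =>
    rename_rowSwap_eq_self (hG0 j j') (hG1 j j')
  -- apply the swap to the expansion
  have hSF : rename (rowSwap x) F = ∑ j, ∑ j', X (x 1 j) * X (x 0 j') * G j j' := by
    rw [hF]
    simp only [map_sum, map_mul, rename_X, rowSwap_apply_row0 hx, rowSwap_apply_row1 hx, hGfix]
  -- `F + swap F = 0`, written as ONE expansion with coefficients `G j j' + G j' j`
  have hsum : ∑ j : Fin 2, ∑ j' : Fin 2, X (x 0 j) * X (x 1 j') * (G j j' + G j' j) = 0 := by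
    have h : ∑ j : Fin 2, ∑ j' : Fin 2, X (x 0 j) * X (x 1 j') * (G j j' + G j' j) = F + rename (rowSwap x) F := by
      rw [hSF, hF]
      simp only [Fin.sum_univ_two]
      ring
    rw [h, hS, add_neg_cancel]
  -- extract: `G k k' + G k' k = 0`
  have hanti : ∀ k k', G k k' + G k' k = 0 := by
    intro k k'
    have := pderiv₂_sum_XX_mul hx (G := fun j j' => G j j' + G j' j)
      (fun j j' => IsWeightedHomogeneous.add (hG0 j j') (hG0 j' j))
      (fun j j' => IsWeightedHomogeneous.add (hG1 j j') (hG1 j' j)) k k'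
    rw [hsum, map_zero, map_zero] at this
    exact this.symm
  have htwo : ∀ P : MvPolynomial τ ℂ, P + P = 0 → P = 0 := fun P hP => by
    rw [← two_smul ℂ] at hP
    exact (smul_eq_zero.mp hP).resolve_left two_ne_zero
  have h00 : G 0 0 = 0 := htwo _ (hanti 0 0)
  have h11 : G 1 1 = 0 := htwo _ (hanti 1 1)
  have h10 : G 1 0 = -G 0 1 := by have := hanti 0 1; linear_combination this
  rw [hF, Fin.sum_univ_two, Fin.sum_univ_two, Fin.sum_univ_two, h00, h11, h10, det2]
  ring

/-- **`det`-isotypic ⟹ `det(z) ·` (`z`-free)**: a polynomial with row weights `(1,1)` which is ANTISYMMETRIC under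
the row swap is `det2 x * G` with `G := ∂_{11} ∂_{00} F` free of the array variables. [cite: KashiwaraVergne1978, Ch. III §5] -/
theorem eq_det2_mul_of_rowSwap [Fintype τ] {F : MvPolynomial τ ℂ} (h0 : IsWeightedHomogeneous (rowWt x 0) F 1)
    (h1 : IsWeightedHomogeneous (rowWt x 1) F 1) (hS : rename (rowSwap x) F = -F) :
    F = det2 x * pderiv (x 1 1) (pderiv (x 0 0) F) ∧
      (∀ a, IsWeightedHomogeneous (rowWt x a) (pderiv (x 1 1) (pderiv (x 0 0) F)) 0) :=
  ⟨eq_det2_mul_of_expansion hx (G := fun j j' => pderiv (x 1 j') (pderiv (x 0 j) F))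
      (fun j j' => pderiv₂_rowWt_zero hx h0 h1 j j' 0) (fun j j' => pderiv₂_rowWt_zero hx h0 h1 j j' 1)
      (eq_sum_XX_mul_pderiv₂ hx h0 h1) hS,
    fun a => pderiv₂_rowWt_zero hx h0 h1 0 1 a⟩

/-- Conversely `det2 x * G` with `z`-free `G` is antisymmetric under the row swap … [folklore] -/
theorem rename_rowSwap_det2_mul {G : MvPolynomial τ ℂ} (hG0 : IsWeightedHomogeneous (rowWt x 0) G 0)
    (hG1 : IsWeightedHomogeneous (rowWt x 1) G 0) : rename (rowSwap x) (det2 x * G) = -(det2 x * G) := by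
  rw [map_mul, rename_rowSwap_eq_self hG0 hG1, det2]
  simp only [map_sub, map_mul, rename_X, rowSwap_apply_row0 hx, rowSwap_apply_row1 hx]
  ring

omit hx in
/-- … and has row weights `(1,1)`. [folklore] -/
theorem isWeightedHomogeneous_rowWt_det2_mul (hx : Function.Injective fun p : Fin 2 × Fin 2 => x p.1 p.2)
    {G : MvPolynomial τ ℂ} (a : Fin 2) (hG : IsWeightedHomogeneous (rowWt x a) G 0) :
    IsWeightedHomogeneous (rowWt x a) (det2 x * G) 1 := by
  have key : ∀ j j', rowWt x a (x 0 j) + rowWt x a (x 1 j') = 1 := by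
    intro j j'
    by_cases ha : a = 0
    · subst ha; rw [rowWt_apply_same, rowWt_apply_other hx one_ne_zero]
    · obtain rfl : a = 1 := by omega
      rw [rowWt_apply_same, rowWt_apply_other hx zero_ne_one]
  have hmon : ∀ j j', IsWeightedHomogeneous (rowWt x a) (X (x 0 j) * X (x 1 j') : MvPolynomial τ ℂ) 1 := by
    intro j j'
    have h := (isWeightedHomogeneous_X ℂ (rowWt x a) (x 0 j)).mul (isWeightedHomogeneous_X ℂ (rowWt x a) (x 1 j'))
    rwa [key] at h
  have hdet : IsWeightedHomogeneous (rowWt x a) (det2 x) 1 := by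
    rw [det2]
    exact (weightedHomogeneousSubmodule ℂ (rowWt x a) 1).sub_mem (hmon 0 1) (hmon 1 0)
  simpa using hdet.mul hG

end Swap

end Literature.Analysis.SegalBargmann

end
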